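import Literature.MathematicalPhysics.QuantumFieldTheory.Balaban1983to89.B9Thm37GlueChart
import Literature.MathematicalPhysics.QuantumFieldTheory.Balaban1983to89.B6Lemma21Arith

/-!
# `Balaban1983to89.B9Thm37GlueTorus` — the ONE-SCALE ℓ¹ TORUS GEOMETRY: the distance axioms, the chart
# hypotheses and Lemma 2.1 (2.61)/(2.63) of [4] AT ONE SCALE (printed constant) discharged by name; entry 4 of
# (3.42) for G′ with only the analytic hypotheses left (sibling leaf of `B9Thm37GlueChart`; own lineage pv21;
# imports `B9Thm37GlueChart` and the b06 lineage's `B6Lemma21Arith` only; modifies nothing)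

References (bib keys; the tags below cite only these):
* [B9] = `Balaban1985BackgroundPropagators` — T. Bałaban, *Propagators for lattice gauge theories in a background
  field*, Commun. Math. Phys. 99 (1985) 389–434.
* [4] = `Balaban1984PropagatorsII` — T. Bałaban, *Propagators and renormalization transformations for lattice gauge
  theories. II*, Commun. Math. Phys. 96 (1984) 223–250.
* [3] = `Balaban1984PropagatorsI` — T. Bałaban, *Propagators and renormalization transformations for lattice gauge
  theories. I*, Commun. Math. Phys. 95 (1984) 17–40.

THE PRINTED LOCI (all certified in the headers of modules this file imports; nothing new is quoted here).
[4] p. 224 (2.4) and p. 231 (2.46) (header of `B6Geometry`): *"T = ⋃_{j=0}^k B^j(Λ_j), where B⁰(Λ₀) = Λ₀"* and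
*"d(y, y′) = inf_{Γ_{y,y′}} Σ_{j=0}^k (L^jη)^{−1}|Γ_{y,y′} ∩ B^j(Λ_j)|"* (the contour distance); [4] p. 233 and Lemma 2.1
p. 234 (2.61), (2.63) (module `B6`, `B6RandomWalk`: `B6.c0`, `B6.c1`, `Ineq261`, `Ineq263`, with c₁(α) = 12c₀(½α)^d);
[4] p. 233 (2.54) (the triangle inequality, `Triangle254`); [B9] p. 397 (3.41) (the length L^jη, `B9.Geometry.len`)
and p. 409 (3.89) with [4] p. 230 (2.44) (header of `B9Thm37GlueSz`); [3] p. 36 (1.118) (header of `B9Thm37GluePU`);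
[4] p. 225 (2.14) and «(Q′₀λ)(x) = λ(x), x ∈ Λ₀» (header of `B6DomainMajorantSandwich`); [B9] p. 394 (3.24) (header
of `B9Eq319Avg`).

THE POINT (value = kernel-checked bookkeeping, NOT summit progress).  `B9Thm37GlueChart.thm37_entry4_chart` reads
the fine torus `UT N` into an ABSTRACT coarse geometry `g` through an isometric chart and keeps as hypotheses the
distance axioms of `g` (`htri`, `hrefl`, `hdnn`, `hlen`) and Lemma 2.1 of [4] (`h261`, `h263`).  THIS FILE builds
the one-scale coarse geometry itself (MODEL, `DIVERGENCE.md`): `torusGeom N η L M : B9.Geometry` with sites the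
torus points `UT N`, every site of scale 0 (so 𝔅 = Λ₀ = the torus, Δ(y) = B⁰(y) = {y} by (2.4), length
L⁰η = η by (3.41)) and distance the ℓ¹ TORUS DISTANCE `tdist1 N x y = Σ_i dist(x_i − y_i, N_iℤ)` in lattice units
— at one scale this is the length of a shortest lattice contour from x to y, i.e. the j = 0 member of print's
(2.46) (the localisation vocabulary `Loc`, `Cut` and its norms are NOT modelled: the (3.42) ⇒ (3.89) glue never
touches those fields, they are set to trivial data).  Then, by name: §1 `tdist1` is a pseudometric dominating the
sup-metric `dist` of `UT N`, with nearest neighbours at distance ≤ 1; §2 general DOMINATION CHARTS: the binders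
`hadj`, `hV₁` of `B9Thm37GluePU.thm37_entry4_torus` hold for any chart `e` with `dist x y ≤ g.dist (e x) (e y)` and
unit neighbour steps (the isometric case of `B9Thm37GlueChart` and the ℓ¹ case here are both instances); §3 the
geometry `torusGeom`, its distance axioms (`Triangle254`, reflexivity, nonnegativity, `len = η ≥ 0`) and the
identity chart; §4 LEMMA 2.1 AT ONE SCALE: for αδ₀ > 0 the circle sum `Σ_{t ∈ ℤ/Mℤ} e^{−αδ₀dist(c−t, Mℤ)} ≤ c₀(α)`
(distinct centred representatives, `B5TorusCover.crep_sub_injective`), hence by coordinatewise factorisation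
`Σ_{y} e^{−αδ₀d₁(x,y)} ≤ c₀(α)^d ≤ c₀(½α)^d ≤ 12c₀(½α)^d = c₁(α)`: (2.61) holds on the one-scale torus with the
PRINTED constant and without the largeness condition (2.59) (which controls the scale-changing legs absent here;
cell record: on multiscale slab geometries the printed c₁ is exceeded, `B6Lemma21Counterexample`, GAPS G-A11-1 —
not at one scale), and (2.63) follows by the tree's `B6RandomWalk.ineq263_of_261` ((2.54) + α ≤ 1); §5 the
corollary `thm37_entry4_l1`: entry 4 of (3.42) for G′ = (Δ_U + Q)^{−1} on `torusGeom` in which the geometry, the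
partition of unity AND the random-walk summability are all discharged — the remaining hypotheses are exactly the
orthogonality `hRm` of the rotation matrices, the numeric ranges (0 < δ₀, 0 < α ≤ 1, ρ ≥ 1, …), the located
smallness `hsmall` (explicit), the Q-data (`hKQ`, `hlocQ`, `hrowQ`, `hQ`), Corollary 3.6 for the G′_□ (`h342_*`),
`hloc` and `hinv` (and the torus/cube compatibility 1 ≤ M₀ ∣ N_i, 2M₀ ≤ N_i of the b05 cover); §6 non-vacuity of
`hRm` (U = 1); §7 (v2, APPEND-ONLY over v1: every v1 declaration byte-identical) the Q-PART AT ONE SCALE: by [4]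
p. 225 ((2.14) and «(Q′₀λ)(x) = λ(x), x ∈ Λ₀») and [B9] (3.24) the operator Q′\*aQ′ is diagonal at one scale, so
[h_□, Q′\*aQ′] = 0 (`mulOp_comm_sub_eq_zero`, `hQ_diag`) and the Q-binders are discharged with K_Q := 0, κ_Q := 0:
`thm37_entry4_l1_diag`, whose remaining hypotheses are the compatibility, `hRm`, the ranges, `hsmall`,
Corollary 3.6 for the G′_□ (`h342_*`), `hloc`, `hinv`.

NOT ASSERTED.  Everything listed as remaining; the multiscale set 𝔅 and the k ≥ 1 members of (2.46); that print's
proof of Lemma 2.1 is the one-scale computation (it is not: print's content is the multiscale case under (2.59));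
the localisation fields of `torusGeom` (trivial data, no meaning); the b05 profile; optimal constants.
-/

namespace Literature.MathematicalPhysics.QuantumFieldTheory.Balaban1983to89.B9Thm37GlueTorus

open Finset B6RandomWalk B6RandomWalkHom B9Thm37Sum B9Thm34Ext B9Thm37Glue B9Thm37GlueT B9Thm37GlueSt B9Thm37GlueSz
open B9Thm37GluePU B9Thm37GlueChart
open B4TorusKernel.MultiPeriod (circAbs centre circAbs_nonneg abs_add_mul_centre)
open B4Sect5Torus (TSite ccoord tdist ccoord_cast ccoord_symm ccoord_self ccoord_triangle)
open B5TorusCover (UT Ctr ctr ctrU crep abs_crep crep_sub_injective)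
open B5SmoothPartition (hSU)
open B5Leibniz121 (up dn dist_up_le)

noncomputable section

variable {d : ℕ} {N : Fin d → ℕ}

/-! ## §1  The ℓ¹ torus distance -/

section L1

variable [∀ i, NeZero (N i)]

/-- MODEL. The ℓ¹ torus distance in lattice units, `d₁(x, y) = Σ_i dist(x_i − y_i, N_iℤ)` — at one scale (j = 0,
unit bonds) the length of a shortest lattice contour joining x to y, the j = 0 member of (2.46). [cite: Balaban1984PropagatorsII, (2.46) p.231] -/
def tdist1 (N : Fin d → ℕ) [∀ i, NeZero (N i)] (x y : UT N) : ℝ :=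
  ∑ i, ((ccoord N (UT.toSite N x) (UT.toSite N y) i : ℕ) : ℝ)

/-- `d₁(x, x) = 0`. [folklore] -/
theorem tdist1_self (x : UT N) : tdist1 N x x = 0 := by
  unfold tdist1
  exact Finset.sum_eq_zero fun i _ => by rw [ccoord_self, Nat.cast_zero]

/-- `d₁` is symmetric. [folklore] -/
theorem tdist1_comm (x y : UT N) : tdist1 N x y = tdist1 N y x := by
  unfold tdist1
  exact Finset.sum_congr rfl fun i _ => by rw [ccoord_symm (UT.one_le N)]

/-- `d₁` satisfies the triangle inequality ((2.54) for this distance). [cite: Balaban1984PropagatorsII, (2.54) p.233] -/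
theorem tdist1_triangle (x y z : UT N) : tdist1 N x z ≤ tdist1 N x y + tdist1 N y z := by
  unfold tdist1
  rw [← Finset.sum_add_distrib]
  exact Finset.sum_le_sum fun i _ => by exact_mod_cast ccoord_triangle (UT.one_le N) _ _ _ i

/-- `0 ≤ d₁`. [folklore] -/
theorem tdist1_nonneg (x y : UT N) : 0 ≤ tdist1 N x y :=
  Finset.sum_nonneg fun _ _ => Nat.cast_nonneg _

/-- The ℓ¹ distance dominates the sup-distance `dist` of the carrier `UT N`. [folklore] -/
theorem dist_le_tdist1 (x y : UT N) : dist x y ≤ tdist1 N x y := by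
  rw [UT.dist_eq]
  unfold tdist tdist1
  have h : (Finset.univ.sup (ccoord N (UT.toSite N x) (UT.toSite N y)) : ℕ) ≤
      ∑ j, (ccoord N (UT.toSite N x) (UT.toSite N y) j : ℕ) :=
    Finset.sup_le fun j _ => Finset.single_le_sum (fun _ _ => Nat.zero_le _) (Finset.mem_univ j)
  exact_mod_cast h

omit [∀ i, NeZero (N i)] in
/-- A coordinate not touched by an update contributes nothing. [folklore] -/
theorem ccoord_update_of_ne (s : TSite d N) (μ : Fin d) (v : Fin (N μ)) {i : Fin d} (hi : i ≠ μ) :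
    ccoord N s (Function.update s μ v) i = 0 := by
  unfold ccoord
  rw [Function.update_of_ne hi, sub_self, B4Sect5Torus.circAbs_zero]
  rfl

/-- Nearest neighbours are at ℓ¹ distance ≤ 1: `d₁(x, x + e_μ) ≤ 1`. [folklore] -/
theorem tdist1_up_le (x : UT N) (μ : Fin d) : tdist1 N x (up x μ) ≤ 1 := by
  have hsum : tdist1 N x (up x μ) = ((ccoord N (UT.toSite N x) (UT.toSite N (up x μ)) μ : ℕ) : ℝ) := by
    unfold tdist1
    rw [Finset.sum_eq_single μ]
    · intro i _ hi
      have : ccoord N (UT.toSite N x) (UT.toSite N (up x μ)) i = 0 := by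
        unfold B5Leibniz121.up
        rw [UT.toSite_ofSite]
        exact ccoord_update_of_ne (UT.toSite N x) μ _ hi
      rw [this, Nat.cast_zero]
    · intro h; exact absurd (Finset.mem_univ μ) h
  have hle : ((ccoord N (UT.toSite N x) (UT.toSite N (up x μ)) μ : ℕ) : ℝ) ≤ dist x (up x μ) := by
    rw [UT.dist_eq]
    unfold tdist
    exact_mod_cast Finset.le_sup (f := ccoord N (UT.toSite N x) (UT.toSite N (up x μ))) (Finset.mem_univ μ)
  rw [hsum]
  exact hle.trans (dist_up_le x μ)

/-- `d₁(x + e_μ, x) ≤ 1`. [folklore] -/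
theorem tdist1_up_le' (x : UT N) (μ : Fin d) : tdist1 N (up x μ) x ≤ 1 := by
  rw [tdist1_comm]; exact tdist1_up_le x μ

end L1

/-! ## §2  Domination charts: `hadj` and `hV₁` beyond the isometric case -/

section Domination

variable {g : B9.Geometry} {Cp : Type} [∀ i, NeZero (N i)]

/-- **The binder `hadj`** for a chart with unit neighbour steps: if `g.dist (e x) (e x) ≤ 0` and
`g.dist (e x) (e (x + e_μ)), g.dist (e (x + e_μ)) (e x) ≤ 1`, then the four ρ-adjacencies of bond blocks hold for
every ρ ≥ 1. [cite: Balaban1985BackgroundPropagators, (3.3) p.391 + (3.41) p.397] -/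
theorem hadj_of_nb {e : UT N → g.Site} (h0 : ∀ x : UT N, g.dist (e x) (e x) ≤ 0)
    (hnb : ∀ (x : UT N) (μ : Fin d), g.dist (e x) (e (up x μ)) ≤ 1 ∧ g.dist (e (up x μ)) (e x) ≤ 1)
    {ρ : ℝ} (hρ : 1 ≤ ρ) :
    ∀ (b : UT N × Fin d) (i k : Cp),
      g.dist (cblk e (bsrc b, i)) (cblkY e (b, k)) ≤ ρ ∧ g.dist (cblk e (btgt b, i)) (cblkY e (b, k)) ≤ ρ ∧
        g.dist (cblkY e (b, k)) (cblk e (bsrc b, i)) ≤ ρ ∧ g.dist (cblkY e (b, k)) (cblk e (btgt b, i)) ≤ ρ := by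
  intro b i k
  have h00 : g.dist (e b.1) (e b.1) ≤ ρ := (h0 b.1).trans (by linarith)
  have h1 : g.dist (e (up b.1 b.2)) (e b.1) ≤ ρ := (hnb b.1 b.2).2.trans hρ
  have h2 : g.dist (e b.1) (e (up b.1 b.2)) ≤ ρ := (hnb b.1 b.2).1.trans hρ
  simp only [cblk_apply, cblkY_apply, bsrc, btgt]
  exact ⟨h00, h1, h00, h2⟩

variable [DecidableEq g.Site]

/-- The local volume of a located support set for a DOMINATING chart (`dist x y ≤ g.dist (e x) (e y)`):
`Σ_{y ∈ S′_z, g.dist(e x, y) ≤ ρ} len y ≤ (2⌊ρ⌋+1)^d·ℓ` — a g-ball on the chart lies inside a sup-ball of the torus.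
[cite: Balaban1985BackgroundPropagators, (3.41) p.397; Balaban1984PropagatorsII, (2.44) p.230] -/
theorem localVol_le_of_ge {e : UT N → g.Site} (hge : ∀ x y : UT N, dist x y ≤ g.dist (e x) (e y))
    {ℓ : ℝ} (hℓ : 0 ≤ ℓ) (hlenE : ∀ x, g.len (e x) = ℓ) {M₀ : ℕ} {r ρ : ℝ} (hρ : 0 ≤ ρ) (z : Ctr N M₀) (x : UT N) :
    ∑ y ∈ (Sball e M₀ r z).filter (fun y => g.dist (e x) y ≤ ρ), g.len y ≤ (2 * ⌊ρ⌋₊ + 1 : ℝ) ^ d * ℓ := by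
  set T := (Sball e M₀ r z).filter (fun y => g.dist (e x) y ≤ ρ) with hT
  have hlenT : ∀ y ∈ T, g.len y = ℓ := fun y hy =>
    len_eq_of_mem_Sball hlenE (Finset.mem_filter.mp hy).1
  have hsub : T ⊆ (Finset.univ.filter fun w : UT N => dist x w ≤ ρ).image e := by
    intro y hy
    obtain ⟨hyS, hyd⟩ := Finset.mem_filter.mp hy
    obtain ⟨w, rfl, -⟩ := exists_of_mem_Sball hyS
    exact Finset.mem_image.mpr ⟨w, Finset.mem_filter.mpr ⟨Finset.mem_univ _, (hge x w).trans hyd⟩, rfl⟩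
  have hcard : (T.card : ℝ) ≤ (2 * ⌊ρ⌋₊ + 1 : ℝ) ^ d :=
    calc (T.card : ℝ) ≤ (((Finset.univ.filter fun w : UT N => dist x w ≤ ρ).image e).card : ℝ) := by
          exact_mod_cast Finset.card_le_card hsub
      _ ≤ ((Finset.univ.filter fun w : UT N => dist x w ≤ ρ).card : ℝ) := by
          exact_mod_cast Finset.card_image_le
      _ ≤ (2 * ⌊ρ⌋₊ + 1 : ℝ) ^ d := ballCard_UT_le x hρ
  calc ∑ y ∈ T, g.len y = ∑ _y ∈ T, ℓ := Finset.sum_congr rfl hlenT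
    _ = (T.card : ℝ) * ℓ := by rw [Finset.sum_const, nsmul_eq_mul]
    _ ≤ (2 * ⌊ρ⌋₊ + 1 : ℝ) ^ d * ℓ := mul_le_mul_of_nonneg_right hcard hℓ

/-- **The binder `hV₁`** for a dominating chart, with `v₁ := |c₀|(4d/M₀)·(2⌊ρ⌋+1)^d·ℓ`. [cite: Balaban1985BackgroundPropagators, (3.89) p.409; Balaban1984PropagatorsII, (2.44) p.230] -/
theorem hV₁_of_ge {e : UT N → g.Site} (hge : ∀ x y : UT N, dist x y ≤ g.dist (e x) (e y))
    {ℓ : ℝ} (hℓ : 0 ≤ ℓ) (hlenE : ∀ x, g.len (e x) = ℓ) {M₀ : ℕ} {ρ : ℝ} (hρ : 0 ≤ ρ) (c₀ : ℝ) :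
    ∀ (z : Ctr N M₀) (a : g.Site), a ∈ Sball e M₀ (M₀ + 1) z →
      |c₀| * (4 * d / (M₀ : ℝ)) * ∑ y ∈ (Sball e M₀ (M₀ + 1) z).filter (fun y => g.dist a y ≤ ρ), g.len y ≤
        |c₀| * (4 * d / (M₀ : ℝ)) * ((2 * ⌊ρ⌋₊ + 1 : ℝ) ^ d * ℓ) := by
  intro z a ha
  obtain ⟨x, rfl, -⟩ := exists_of_mem_Sball ha
  exact mul_le_mul_of_nonneg_left (localVol_le_of_ge hge hℓ hlenE hρ z x) (by positivity)

end Domination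

/-! ## §3  The one-scale ℓ¹ torus geometry and its identity chart -/

section Geom

variable [∀ i, NeZero (N i)]

/-- MODEL. The one-scale coarse geometry of the torus: sites `UT N`, every site of scale 0 (𝔅 = Λ₀, Δ(y) = {y},
length L⁰η = η), distance the ℓ¹ torus distance `tdist1`; the localisation vocabulary (`Loc`, `Cut`, norms) is NOT
modelled (trivial data — the (3.42) ⇒ (3.89) glue never reads it). [cite: Balaban1984PropagatorsII, (2.4) p.224 + (2.46) p.231; Balaban1985BackgroundPropagators, (3.41) p.397] -/
abbrev torusGeom (N : Fin d → ℕ) [∀ i, NeZero (N i)] (η L M : ℝ) : B9.Geometry where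
  Site := UT N
  scale := fun _ => 0
  dist := tdist1 N
  k := 0
  eta := η
  L := L
  M := M
  Loc := Unit
  suppIn := fun _ _ => True
  suppInT := fun _ _ => True
  supNorm := fun _ => 0
  l2Norm := fun _ => 0
  wNorm := fun _ _ => 0
  holder := fun _ _ => 0
  Cut := Unit
  cutIn := fun _ _ => True
  cutInT := fun _ _ => True
  cutH := fun _ _ => 0
  cutSup := fun _ => 0
  suppInT_of_suppIn := fun _ _ h => h
  cutInT_of_cutIn := fun _ _ h => h

variable (η L M : ℝ)

/-- Every length of the one-scale geometry is η (L⁰·η). [cite: Balaban1985BackgroundPropagators, (3.41) p.397] -/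
theorem len_torusGeom (y : (torusGeom N η L M).Site) : (torusGeom N η L M).len y = η := by
  simp [B9.Geometry.len]

/-- The distance of the one-scale geometry is `tdist1`. [folklore] -/
theorem dist_torusGeom (x y : (torusGeom N η L M).Site) : (torusGeom N η L M).dist x y = tdist1 N x y := rfl

/-- **`htri` discharged**: (2.54) for the one-scale geometry, in the `toB6` repackaging. [cite: Balaban1984PropagatorsII, (2.54) p.233] -/
theorem htri_torusGeom (R : ℝ) (H : Prop) : Triangle254 (toB6 (torusGeom N η L M) R H) :=
  fun a b c => tdist1_triangle a b c

/-- **`hrefl` discharged**. [folklore] -/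
theorem hrefl_torusGeom : ∀ y : (torusGeom N η L M).Site, (torusGeom N η L M).dist y y = 0 :=
  fun y => tdist1_self y

/-- **`hdnn` discharged**. [folklore] -/
theorem hdnn_torusGeom : ∀ y y' : (torusGeom N η L M).Site, 0 ≤ (torusGeom N η L M).dist y y' :=
  fun y y' => tdist1_nonneg y y'

/-- **`hlen` discharged** for η ≥ 0. [cite: Balaban1985BackgroundPropagators, (3.41) p.397] -/
theorem hlen_torusGeom (hη : 0 ≤ η) : ∀ y : (torusGeom N η L M).Site, 0 ≤ (torusGeom N η L M).len y :=
  fun y => by rw [len_torusGeom]; exact hη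

/-- The identity chart of the one-scale geometry. [folklore] -/
def chart0 (N : Fin d → ℕ) [∀ i, NeZero (N i)] (η L M : ℝ) : UT N → (torusGeom N η L M).Site := fun x => x

/-- Unfolding of the identity chart. [folklore] -/
@[simp] theorem chart0_apply (x : UT N) : chart0 N η L M x = x := rfl

/-- The identity chart is injective. [folklore] -/
theorem chart0_injective : Function.Injective (chart0 N η L M) := fun _ _ h => h

/-- The identity chart has constant length η. [folklore] -/
theorem len_chart0 : ∀ x : UT N, (torusGeom N η L M).len (chart0 N η L M x) = η :=
  fun x => len_torusGeom η L M x

/-- The identity chart dominates the sup-distance. [folklore] -/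
theorem hge_chart0 : ∀ x y : UT N, dist x y ≤ (torusGeom N η L M).dist (chart0 N η L M x) (chart0 N η L M y) :=
  fun x y => dist_le_tdist1 x y

/-- The identity chart is reflexive-null. [folklore] -/
theorem h0_chart0 : ∀ x : UT N, (torusGeom N η L M).dist (chart0 N η L M x) (chart0 N η L M x) ≤ 0 :=
  fun x => (tdist1_self x).le

/-- The identity chart has unit neighbour steps. [folklore] -/
theorem hnb_chart0 : ∀ (x : UT N) (μ : Fin d),
    (torusGeom N η L M).dist (chart0 N η L M x) (chart0 N η L M (up x μ)) ≤ 1 ∧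
      (torusGeom N η L M).dist (chart0 N η L M (up x μ)) (chart0 N η L M x) ≤ 1 :=
  fun x μ => ⟨tdist1_up_le x μ, tdist1_up_le' x μ⟩

end Geom

/-! ## §4  Lemma 2.1 of [4] at one scale: (2.61) and (2.63) with the printed constant -/

section Lemma21

/-- **The circle sum**: for `M ≥ 1`, `αδ₀ > 0` and every centre `c ∈ ℤ`,
`Σ_{t ∈ ℤ/Mℤ} e^{−αδ₀·dist(c − t, Mℤ)} ≤ c₀(α) = Σ_{z ∈ ℤ} e^{−αδ₀|z|}` (the classes `c − t` have distinct centred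
representatives `crep`, of absolute value the circular distance; a finite partial sum of the defining series of c₀).
[cite: Balaban1984PropagatorsII, p.233 (c₀(α))] -/
theorem circleSum_le_c0 {M : ℕ} (hM : 1 ≤ M) (c : ℤ) {δ₀ α : ℝ} (ha : 0 < α * δ₀) :
    ∑ t : Fin M, Real.exp (-(α * δ₀ * (circAbs M (c - (t.val : ℤ)) : ℝ))) ≤ B6.c0 δ₀ α := by
  classical
  set φ : Fin M → ℤ := fun t => crep M (c - (t.val : ℤ)) with hφ
  have hφinj : Function.Injective φ := crep_sub_injective M c
  have step1 : ∑ t : Fin M, Real.exp (-(α * δ₀ * (circAbs M (c - (t.val : ℤ)) : ℝ))) =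
      ∑ t : Fin M, Real.exp (-(α * δ₀ * |(φ t : ℝ)|)) := by
    apply Finset.sum_congr rfl
    intro t _
    rw [← Int.cast_abs, hφ, abs_crep hM]
  have step2 : ∑ t : Fin M, Real.exp (-(α * δ₀ * |(φ t : ℝ)|)) =
      ∑ z ∈ Finset.univ.image φ, Real.exp (-(α * δ₀ * |(z : ℝ)|)) := by
    rw [Finset.sum_image (fun x _ y _ h => hφinj h)]
  rw [step1, step2]
  unfold B6.c0
  exact (B6Lemma21Arith.summable_c0_term ha).sum_le_tsum _ fun z _ => (Real.exp_pos _).le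

variable [∀ i, NeZero (N i)]

/-- Coordinatewise factorisation of the ℓ¹ weight: `e^{−a·d₁(x,y)} = Π_i e^{−a·dist(x_i − y_i, N_iℤ)}`. [folklore] -/
theorem exp_tdist1_eq_prod (a : ℝ) (x y : UT N) :
    Real.exp (-(a * tdist1 N x y)) =
      ∏ i, Real.exp (-(a * (circAbs (N i) (((UT.toSite N x i).val : ℤ) - ((UT.toSite N y i).val : ℤ)) : ℝ))) := by
  rw [← Real.exp_sum]
  congr 1
  unfold tdist1
  rw [Finset.mul_sum, ← Finset.sum_neg_distrib]
  apply Finset.sum_congr rfl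
  intro i _
  have hc : ((ccoord N (UT.toSite N x) (UT.toSite N y) i : ℕ) : ℝ) =
      (circAbs (N i) (((UT.toSite N x i).val : ℤ) - ((UT.toSite N y i).val : ℤ)) : ℝ) := by
    have h := ccoord_cast (UT.one_le N) (UT.toSite N x) (UT.toSite N y) i
    exact_mod_cast h
  rw [hc]

/-- **(2.61) AT ONE SCALE, sharp form**: `Σ_{y ∈ torus} e^{−αδ₀d₁(x,y)} ≤ c₀(α)^d` for αδ₀ > 0, uniformly in the
torus size (factorisation + `circleSum_le_c0`). [cite: Balaban1984PropagatorsII, (2.61) p.234] -/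
theorem torusSum_tdist1_le (x : UT N) {δ₀ α : ℝ} (ha : 0 < α * δ₀) :
    ∑ y : UT N, Real.exp (-(α * δ₀ * tdist1 N x y)) ≤ B6.c0 δ₀ α ^ d := by
  classical
  calc ∑ y : UT N, Real.exp (-(α * δ₀ * tdist1 N x y))
      = ∑ y : UT N, ∏ i, Real.exp
          (-(α * δ₀ * (circAbs (N i) (((UT.toSite N x i).val : ℤ) - ((UT.toSite N y i).val : ℤ)) : ℝ))) :=
        Finset.sum_congr rfl fun y _ => exp_tdist1_eq_prod _ x y
    _ = ∏ i : Fin d, ∑ t : Fin (N i),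
          Real.exp (-(α * δ₀ * (circAbs (N i) (((UT.toSite N x i).val : ℤ) - (t.val : ℤ)) : ℝ))) :=
        (Fintype.prod_sum (fun i (t : Fin (N i)) =>
          Real.exp (-(α * δ₀ * (circAbs (N i) (((UT.toSite N x i).val : ℤ) - (t.val : ℤ)) : ℝ))))).symm
    _ ≤ ∏ _i : Fin d, B6.c0 δ₀ α := by
        apply Finset.prod_le_prod
        · intro i _; exact Finset.sum_nonneg fun t _ => (Real.exp_pos _).le
        · intro i _; exact circleSum_le_c0 (UT.one_le N i) _ ha
    _ = B6.c0 δ₀ α ^ d := by rw [Finset.prod_const, Finset.card_univ, Fintype.card_fin]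

/-- `c₀` is antitone in the rate: `c₀(α) ≤ c₀(½α)` for α, δ₀ > 0. [cite: Balaban1984PropagatorsII, p.233] -/
theorem c0_le_c0_half {δ₀ α : ℝ} (hα : 0 < α) (hδ : 0 < δ₀) : B6.c0 δ₀ α ≤ B6.c0 δ₀ (α / 2) := by
  unfold B6.c0
  refine Summable.tsum_le_tsum (fun z => ?_) (B6Lemma21Arith.summable_c0_term (mul_pos hα hδ))
    (B6Lemma21Arith.summable_c0_term (mul_pos (half_pos hα) hδ))
  apply Real.exp_le_exp.mpr
  have hz : 0 ≤ |(z : ℝ)| := abs_nonneg _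
  nlinarith [mul_nonneg (mul_pos hα hδ).le hz]

/-- The one-scale constant is below the printed one: `c₀(α)^d ≤ c₁(α) = 12c₀(½α)^d`. [cite: Balaban1984PropagatorsII, Lemma 2.1 p.234] -/
theorem c0_pow_le_c1 (d : ℕ) {δ₀ α : ℝ} (hα : 0 < α) (hδ : 0 < δ₀) : B6.c0 δ₀ α ^ d ≤ B6.c1 d δ₀ α := by
  unfold B6.c1
  have h0 : 0 ≤ B6.c0 δ₀ α := c0_nonneg δ₀ α
  have h1 : B6.c0 δ₀ α ^ d ≤ B6.c0 δ₀ (α / 2) ^ d := pow_le_pow_left₀ h0 (c0_le_c0_half hα hδ) d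
  have h2 : 0 ≤ B6.c0 δ₀ (α / 2) ^ d := pow_nonneg (c0_nonneg δ₀ (α / 2)) d
  nlinarith

variable (η L M : ℝ)

/-- **`h261` DISCHARGED on the one-scale torus geometry**: (2.61) of Lemma 2.1 of [4] with the printed constant
c₁(α) = 12c₀(½α)^d, for every torus size and all α, δ₀ > 0 (no condition (2.59): at one scale there are no
scale-changing legs). [cite: Balaban1984PropagatorsII, (2.61) p.234] -/
theorem h261_torusGeom (R : ℝ) (H : Prop) {δ₀ α : ℝ} (hα : 0 < α) (hδ : 0 < δ₀) :
    Ineq261 d (toB6 (torusGeom N η L M) R H) δ₀ α := fun y =>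
  (torusSum_tdist1_le y (mul_pos hα hδ)).trans (c0_pow_le_c1 d hα hδ)

/-- **`h263` DISCHARGED on the one-scale torus geometry**: (2.63) of Lemma 2.1 of [4] for 0 < α ≤ 1, δ₀ > 0, by the
tree's (2.61) + (2.54) ⇒ (2.63) (`B6RandomWalk.ineq263_of_261`). [cite: Balaban1984PropagatorsII, (2.63) p.234] -/
theorem h263_torusGeom (R : ℝ) (H : Prop) {δ₀ α : ℝ} (hα : 0 < α) (hα1 : α ≤ 1) (hδ : 0 < δ₀) :
    Ineq263 d (toB6 (torusGeom N η L M) R H) δ₀ α :=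
  ineq263_of_261 d _ δ₀ α (htri_torusGeom η L M R H) hδ.le hα1 (h261_torusGeom η L M R H hα hδ)

end Lemma21

/-! ## §5  Entry 4 of (3.42) for G′ on the one-scale torus geometry: only the analytic hypotheses remain -/

section Entry4

variable [∀ i, NeZero (N i)] {Cp : Type}

/-- **Theorem 3.7 ⇒ entry 4 of (3.42) for G′ (Δ_UG′, weight 1) ON THE ONE-SCALE ℓ¹ TORUS GEOMETRY** =
`B9Thm37GluePU.thm37_entry4_torus` for `g := torusGeom N η L M` (R, H the `toB6` parameters), identity chart,
`S_z`, `S′_z` the torus balls, `N := 5^d`, `N′ := 7^d`, `v₁ := |c₀|(4d/M₀)(2⌊ρ⌋+1)^d·η`, `v₂ := c₀²(52d/M₀²)η²`,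
`dd := d`, with the partition-of-unity binders (GluePU), the seven geometry binders (GlueChart §2 and §2 here), the
distance axioms `htri`/`hrefl`/`hdnn`/`hlen` (§3) AND Lemma 2.1 `h261`/`h263` (§4) ALL DISCHARGED.  Remaining
hypotheses, carried verbatim (NOT asserted): the torus/cube compatibility 1 ≤ M₀, M₀ ∣ N_i, 2M₀ ≤ N_i of the b05
cover; `hRm`; the ranges 0 ≤ B₀, 0 < δ₀, 0 < α ≤ 1, 1 ≤ ρ, 0 ≤ κ_Q, 0 ≤ η; the located smallness `hsmall`; the
Q-data `hKQ`, `hlocQ`, `hrowQ`, `hQ`; Corollary 3.6 for the G′_□ (`h342_*`, kernels written with the length η and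
the distance `tdist1`); `hloc`; `hinv`. [cite: Balaban1985BackgroundPropagators, Thm 3.7 (3.87)–(3.90) pp.408–410 + (3.42) p.397; Balaban1984PropagatorsII, Lemma 2.1 p.234 + (2.44) p.230] -/
theorem thm37_entry4_l1 [Fintype Cp] [DecidableEq Cp] {M₀ : ℕ} (hM : 1 ≤ M₀) (hdiv : ∀ i, M₀ ∣ N i)
    (h2N : ∀ i, 2 * M₀ ≤ N i) (η L M R : ℝ) (H : Prop) (hη : 0 ≤ η) (c₀ : ℝ)
    (Rm : UT N × Fin d → Cp → Cp → ℝ) (Qf : Module.End ℝ (UT N × Cp → ℝ)) (δ₀ α ρ B₀ κQ : ℝ)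
    (KQ : Ctr N M₀ → UT N → UT N → ℝ) {G' : Module.End ℝ (UT N × Cp → ℝ)}
    (hRm : ∀ b i j, ∑ k, Rm b k i * Rm b k j = if i = j then 1 else 0)
    (hB₀ : 0 ≤ B₀) (hδ₀ : 0 < δ₀) (hα : 0 < α) (hα1 : α ≤ 1) (hρ : 1 ≤ ρ) (hκQ : 0 ≤ κQ)
    (hsmall : (7 : ℝ) ^ d * (B₀ * Real.exp (δ₀ * ρ) *
        ((d + d * Fintype.card Cp : ℝ) * (|c₀| * (4 * d / (M₀ : ℝ)) * ((2 * ⌊ρ⌋₊ + 1 : ℝ) ^ d * η)) +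
          (c₀ ^ 2 * (52 * d / (M₀ : ℝ) ^ 2) * η ^ 2 + κQ))) * B6.c1 d δ₀ α < 1)
    (hKQ : ∀ i a b, 0 ≤ KQ i a b) (hlocQ : ∀ i a y'', KQ i a y'' ≠ 0 → tdist1 N a y'' ≤ ρ)
    (hrowQ : ∀ i (a : UT N), ∑ y'' : UT N, KQ i a y'' * η ^ 2 ≤
      if a ∈ Sball (chart0 N η L M) M₀ (M₀ + 1) i then κQ else 0)
    {Gsq : Ctr N M₀ → Module.End ℝ (UT N × Cp → ℝ)}
    (h342_1 : ∀ i, HasMajorant (g := toB6 (torusGeom N η L M) R H) (cblk (chart0 N η L M)) (Gsq i)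
      (fun a b => B₀ * η ^ 2 * Real.exp (-(δ₀ * tdist1 N a b))))
    (h342_2 : ∀ i, HasMajorantHom (g := toB6 (torusGeom N η L M) R H) (cblk (chart0 N η L M))
      (cblkY (chart0 N η L M)) (covD bsrc btgt (fun _ : UT N × Fin d => c₀) Rm ∘ₗ Gsq i)
      (fun a b => B₀ * η * Real.exp (-(δ₀ * tdist1 N a b))))
    (h342_4 : ∀ i, HasMajorantHom (g := toB6 (torusGeom N η L M) R H) (cblk (chart0 N η L M))
      (cblk (chart0 N η L M))
      ((covDT bsrc btgt (fun _ : UT N × Fin d => c₀) Rm ∘ₗ covD bsrc btgt (fun _ : UT N × Fin d => c₀) Rm) ∘ₗ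
        Gsq i)
      (fun a b => B₀ * Real.exp (-(δ₀ * tdist1 N a b))))
    (hQ : ∀ i, HasMajorant (g := toB6 (torusGeom N η L M) R H) (cblk (chart0 N η L M))
      (mulOp (hSU N M₀ i ∘ Prod.fst) * Qf - Qf * mulOp (hSU N M₀ i ∘ Prod.fst)) (KQ i))
    (hloc : ∀ i, mulOp (hSU N M₀ i ∘ Prod.fst) *
      (covDT bsrc btgt (fun _ : UT N × Fin d => c₀) Rm ∘ₗ covD bsrc btgt (fun _ : UT N × Fin d => c₀) Rm + Qf) *
      Gsq i * mulOp (hSU N M₀ i ∘ Prod.fst) = mulOp (hSU N M₀ i ∘ Prod.fst) * mulOp (hSU N M₀ i ∘ Prod.fst))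
    (hinv : G' * (covDT bsrc btgt (fun _ : UT N × Fin d => c₀) Rm ∘ₗ
      covD bsrc btgt (fun _ : UT N × Fin d => c₀) Rm + Qf) = 1) :
    HasMajorantHom (g := toB6 (torusGeom N η L M) R H) (cblk (chart0 N η L M)) (cblk (chart0 N η L M))
      ((covDT bsrc btgt (fun _ : UT N × Fin d => c₀) Rm ∘ₗ covD bsrc btgt (fun _ : UT N × Fin d => c₀) Rm) ∘ₗ G')
      (fun (a b : UT N) => B₀ * ((5 : ℝ) ^ d + (7 : ℝ) ^ d * Real.exp (δ₀ * ρ) *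
          ((d + d * Fintype.card Cp : ℝ) * (|c₀| * (4 * d / (M₀ : ℝ)) * ((2 * ⌊ρ⌋₊ + 1 : ℝ) ^ d * η)) +
            c₀ ^ 2 * (52 * d / (M₀ : ℝ) ^ 2) * η ^ 2)) *
        B6.c1 d δ₀ α *
        (1 - (7 : ℝ) ^ d * (B₀ * Real.exp (δ₀ * ρ) *
          ((d + d * Fintype.card Cp : ℝ) * (|c₀| * (4 * d / (M₀ : ℝ)) * ((2 * ⌊ρ⌋₊ + 1 : ℝ) ^ d * η)) +
            (c₀ ^ 2 * (52 * d / (M₀ : ℝ) ^ 2) * η ^ 2 + κQ))) * B6.c1 d δ₀ α)⁻¹ *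
        Real.exp (-((1 - α) * δ₀ * tdist1 N a b))) := by
  have hαδ : 0 ≤ (1 - α) * δ₀ := mul_nonneg (by linarith) hδ₀.le
  have hrowQ' : ∀ i (a : (torusGeom N η L M).Site), ∑ y'' : (torusGeom N η L M).Site,
      KQ i a y'' * (torusGeom N η L M).len y'' ^ 2 ≤
        if a ∈ Sball (chart0 N η L M) M₀ (M₀ + 1) i then κQ else 0 := by
    intro i a; simpa only [len_torusGeom] using hrowQ i a
  have h342_1' : ∀ i, HasMajorant (g := toB6 (torusGeom N η L M) R H) (cblk (chart0 N η L M)) (Gsq i)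
      (fun a b => B₀ * (torusGeom N η L M).len a ^ 2 *
        Real.exp (-(δ₀ * (torusGeom N η L M).dist a b))) := by
    intro i; simpa only [len_torusGeom] using h342_1 i
  have h342_2' : ∀ i, HasMajorantHom (g := toB6 (torusGeom N η L M) R H) (cblk (chart0 N η L M))
      (cblkY (chart0 N η L M)) (covD bsrc btgt (fun _ : UT N × Fin d => c₀) Rm ∘ₗ Gsq i)
      (fun a b => B₀ * (torusGeom N η L M).len a * Real.exp (-(δ₀ * (torusGeom N η L M).dist a b))) := by
    intro i; simpa only [len_torusGeom] using h342_2 i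
  exact thm37_entry4_torus (g := torusGeom N η L M) (Cp := Cp) hM hdiv h2N c₀ (cblk (chart0 N η L M))
    (cblkY (chart0 N η L M)) Rm Qf d δ₀ α ρ B₀
    (|c₀| * (4 * d / (M₀ : ℝ)) * ((2 * ⌊ρ⌋₊ + 1 : ℝ) ^ d * η)) (c₀ ^ 2 * (52 * d / (M₀ : ℝ) ^ 2) * η ^ 2) κQ
    ((5 : ℝ) ^ d) ((7 : ℝ) ^ d) (Sball (chart0 N η L M) M₀ M₀) (Sball (chart0 N η L M) M₀ (M₀ + 1)) KQ
    hRm hB₀ hδ₀.le (zero_le_one.trans hρ) (by positivity) (by positivity) hκQ (by positivity) (by positivity) hαδ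
    (htri_torusGeom η L M R H) (hrefl_torusGeom η L M) (hdnn_torusGeom η L M) (hlen_torusGeom η L M hη)
    (h261_torusGeom η L M R H hα hδ₀) (h263_torusGeom η L M R H hα hα1 hδ₀) hsmall
    (hS_chart (chart0_injective η L M) hM) (hcnt_chart (chart0_injective η L M) hM)
    (hcnt'_chart (chart0_injective η L M) hM) (hsupp_chart (chart0_injective η L M) hM)
    (hadj_of_nb (h0_chart0 η L M) (hnb_chart0 η L M) hρ)
    (hV₁_of_ge (hge_chart0 η L M) hη (len_chart0 η L M) (zero_le_one.trans hρ) c₀)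
    (hV₂_chart (len_chart0 η L M) c₀) hKQ hlocQ hrowQ' h342_1' h342_2' h342_4 hQ hloc hinv

end Entry4

/-! ## §6  Non-vacuity of the orthogonality binder `hRm` (the background U = 1) -/

/-- At U = 1 the rotation matrices are the identity, which satisfies `hRm`. [folklore] -/
example {Cp : Type} [Fintype Cp] [DecidableEq Cp] (b : UT N × Fin d) (i j : Cp) :
    ∑ k : Cp, (fun (_ : UT N × Fin d) (k i : Cp) => if k = i then (1 : ℝ) else 0) b k i *
        (fun (_ : UT N × Fin d) (k i : Cp) => if k = i then (1 : ℝ) else 0) b k j =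
      if i = j then 1 else 0 := by
  simp only [ite_mul, one_mul, zero_mul, Finset.sum_ite_eq', Finset.mem_univ, if_true]


/-! ## §7  (v2) The Q-part of (3.88) at one scale: Q′₀ = id on Λ₀, Q′\*aQ′ is diagonal, [h_□, Q′\*aQ′] = 0

[4] p. 225 (certified in the header of `B6DomainMajorantSandwich`): *"Δ′_a = Δ + Q′\*aQ′"*, (2.14) *"⟨λ, Q′\*aQ′λ⟩ =
Σ_{j=0}^{k} Σ_{y∈Λ_j} a_j(L^jη)^{d−2}|(Q′_jλ)(y)|²"* and *"we assume that (Q′₀λ)(x) = λ(x), x ∈ Λ₀"*; [B9] p. 394 (3.24)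
(certified in the header of `B9Eq319Avg`): *"Q′\*aQ′ is defined by the same quadratic form as in (2.14)"*.  Hence at ONE
scale (𝔅 = Λ₀) the operator Q′\*aQ′ is DIAGONAL in the points (λ ↦ a₀η^{−2}λ for the η^d-pairing) and commutes with
every multiplication operator h_□: the commutator term [h_□, Q′\*aQ′] of K(h_□) in (3.88) vanishes, so the Q-data of
the lineage are discharged with K_Q := 0, κ_Q := 0.  MODEL: `Qf := mulOp q` for an arbitrary diagonal q (print: the
constant a₀η^{−2}); nothing about the scales j ≥ 1 (where Q′_j averages over blocks and the term is O(M^{−1})) is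
asserted. -/

section Diag

/-- Two multiplication operators commute: `h·q − q·h = 0`. [folklore] -/
theorem mulOp_comm_sub_eq_zero {X : Type} (h q : X → ℝ) : mulOp h * mulOp q - mulOp q * mulOp h = 0 := by
  refine LinearMap.ext fun μ => funext fun x => ?_
  simp only [LinearMap.sub_apply, Module.End.mul_apply, LinearMap.zero_apply, Pi.zero_apply, Pi.sub_apply,
    mulOp_apply]
  ring

variable {g : B9.Geometry} [Fintype g.Site] {R : ℝ} {H : Prop} {X : Type}

/-- **`hQ` discharged at one scale with K_Q := 0**: the commutator of h_□ with a diagonal Q has the zero majorant.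
[cite: Balaban1984PropagatorsII, (2.14) p.225; Balaban1985BackgroundPropagators, (3.24) p.394 + (3.88) p.409] -/
theorem hQ_diag (blk : X → g.Site) (h q : X → ℝ) :
    HasMajorant (g := toB6 g R H) blk (mulOp h * mulOp q - mulOp q * mulOp h) (fun _ _ => 0) := by
  rw [mulOp_comm_sub_eq_zero]
  exact hasMajorant_zero (g := toB6 g R H) blk

end Diag

section Entry4Diag

variable [∀ i, NeZero (N i)] {Cp : Type}

/-- **Entry 4 of (3.42) for G′ = (Δ_U + Q′\*aQ′)^{−1} ON THE ONE-SCALE ℓ¹ TORUS GEOMETRY WITH THE ONE-SCALE Q**: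
`thm37_entry4_l1` with `Qf := mulOp q` (q an arbitrary diagonal; print: a₀η^{−2}), `K_Q := 0`, `κ_Q := 0` — the four
Q-binders `hKQ`, `hlocQ`, `hrowQ`, `hQ` DISCHARGED (§7).  Remaining hypotheses (NOT asserted): the torus/cube
compatibility; `hRm`; the ranges; the located smallness (now without κ_Q); Corollary 3.6 for the G′_□ (`h342_*`);
`hloc`; `hinv`. [cite: Balaban1985BackgroundPropagators, Thm 3.7 (3.87)–(3.90) pp.408–410 + (3.42) p.397 + (3.24) p.394; Balaban1984PropagatorsII, (2.14) p.225 + Lemma 2.1 p.234] -/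
theorem thm37_entry4_l1_diag [Fintype Cp] [DecidableEq Cp] {M₀ : ℕ} (hM : 1 ≤ M₀) (hdiv : ∀ i, M₀ ∣ N i)
    (h2N : ∀ i, 2 * M₀ ≤ N i) (η L M R : ℝ) (H : Prop) (hη : 0 ≤ η) (c₀ : ℝ)
    (Rm : UT N × Fin d → Cp → Cp → ℝ) (q : UT N × Cp → ℝ) (δ₀ α ρ B₀ : ℝ) {G' : Module.End ℝ (UT N × Cp → ℝ)}
    (hRm : ∀ b i j, ∑ k, Rm b k i * Rm b k j = if i = j then 1 else 0)
    (hB₀ : 0 ≤ B₀) (hδ₀ : 0 < δ₀) (hα : 0 < α) (hα1 : α ≤ 1) (hρ : 1 ≤ ρ)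
    (hsmall : (7 : ℝ) ^ d * (B₀ * Real.exp (δ₀ * ρ) *
        ((d + d * Fintype.card Cp : ℝ) * (|c₀| * (4 * d / (M₀ : ℝ)) * ((2 * ⌊ρ⌋₊ + 1 : ℝ) ^ d * η)) +
          c₀ ^ 2 * (52 * d / (M₀ : ℝ) ^ 2) * η ^ 2)) * B6.c1 d δ₀ α < 1)
    {Gsq : Ctr N M₀ → Module.End ℝ (UT N × Cp → ℝ)}
    (h342_1 : ∀ i, HasMajorant (g := toB6 (torusGeom N η L M) R H) (cblk (chart0 N η L M)) (Gsq i)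
      (fun a b => B₀ * η ^ 2 * Real.exp (-(δ₀ * tdist1 N a b))))
    (h342_2 : ∀ i, HasMajorantHom (g := toB6 (torusGeom N η L M) R H) (cblk (chart0 N η L M))
      (cblkY (chart0 N η L M)) (covD bsrc btgt (fun _ : UT N × Fin d => c₀) Rm ∘ₗ Gsq i)
      (fun a b => B₀ * η * Real.exp (-(δ₀ * tdist1 N a b))))
    (h342_4 : ∀ i, HasMajorantHom (g := toB6 (torusGeom N η L M) R H) (cblk (chart0 N η L M))
      (cblk (chart0 N η L M))
      ((covDT bsrc btgt (fun _ : UT N × Fin d => c₀) Rm ∘ₗ covD bsrc btgt (fun _ : UT N × Fin d => c₀) Rm) ∘ₗ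
        Gsq i)
      (fun a b => B₀ * Real.exp (-(δ₀ * tdist1 N a b))))
    (hloc : ∀ i, mulOp (hSU N M₀ i ∘ Prod.fst) *
      (covDT bsrc btgt (fun _ : UT N × Fin d => c₀) Rm ∘ₗ covD bsrc btgt (fun _ : UT N × Fin d => c₀) Rm +
        mulOp q) *
      Gsq i * mulOp (hSU N M₀ i ∘ Prod.fst) = mulOp (hSU N M₀ i ∘ Prod.fst) * mulOp (hSU N M₀ i ∘ Prod.fst))
    (hinv : G' * (covDT bsrc btgt (fun _ : UT N × Fin d => c₀) Rm ∘ₗ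
      covD bsrc btgt (fun _ : UT N × Fin d => c₀) Rm + mulOp q) = 1) :
    HasMajorantHom (g := toB6 (torusGeom N η L M) R H) (cblk (chart0 N η L M)) (cblk (chart0 N η L M))
      ((covDT bsrc btgt (fun _ : UT N × Fin d => c₀) Rm ∘ₗ covD bsrc btgt (fun _ : UT N × Fin d => c₀) Rm) ∘ₗ G')
      (fun (a b : UT N) => B₀ * ((5 : ℝ) ^ d + (7 : ℝ) ^ d * Real.exp (δ₀ * ρ) *
          ((d + d * Fintype.card Cp : ℝ) * (|c₀| * (4 * d / (M₀ : ℝ)) * ((2 * ⌊ρ⌋₊ + 1 : ℝ) ^ d * η)) +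
            c₀ ^ 2 * (52 * d / (M₀ : ℝ) ^ 2) * η ^ 2)) *
        B6.c1 d δ₀ α *
        (1 - (7 : ℝ) ^ d * (B₀ * Real.exp (δ₀ * ρ) *
          ((d + d * Fintype.card Cp : ℝ) * (|c₀| * (4 * d / (M₀ : ℝ)) * ((2 * ⌊ρ⌋₊ + 1 : ℝ) ^ d * η)) +
            c₀ ^ 2 * (52 * d / (M₀ : ℝ) ^ 2) * η ^ 2)) * B6.c1 d δ₀ α)⁻¹ *
        Real.exp (-((1 - α) * δ₀ * tdist1 N a b))) := by
  have hsmall' : (7 : ℝ) ^ d * (B₀ * Real.exp (δ₀ * ρ) *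
      ((d + d * Fintype.card Cp : ℝ) * (|c₀| * (4 * d / (M₀ : ℝ)) * ((2 * ⌊ρ⌋₊ + 1 : ℝ) ^ d * η)) +
        (c₀ ^ 2 * (52 * d / (M₀ : ℝ) ^ 2) * η ^ 2 + 0))) * B6.c1 d δ₀ α < 1 := by
    rw [add_zero]; exact hsmall
  have hrowQ : ∀ (i : Ctr N M₀) (a : UT N), ∑ y'' : UT N, (fun (_ : Ctr N M₀) (_ _ : UT N) => (0 : ℝ)) i a y'' * η ^ 2 ≤
      if a ∈ Sball (chart0 N η L M) M₀ (M₀ + 1) i then (0 : ℝ) else 0 := by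
    intro i a
    rw [ite_self]
    exact le_of_eq (Finset.sum_eq_zero fun _ _ => by rw [zero_mul])
  have h := thm37_entry4_l1 (Cp := Cp) hM hdiv h2N η L M R H hη c₀ Rm (mulOp q) δ₀ α ρ B₀ 0
    (fun _ _ _ => 0) hRm hB₀ hδ₀ hα hα1 hρ le_rfl hsmall' (fun _ _ _ => le_rfl) (fun _ _ _ h => absurd rfl h)
    hrowQ h342_1 h342_2 h342_4 (fun i => hQ_diag (cblk (chart0 N η L M)) (hSU N M₀ i ∘ Prod.fst) q) hloc hinv
  rw [add_zero] at h
  exact h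

end Entry4Diag

end

end Literature.MathematicalPhysics.QuantumFieldTheory.Balaban1983to89.B9Thm37GlueTorus
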